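import Summits.BirchSwinnertonDyer.BirchSwinnertonDyer.Theorems.Rank2Observatory2DescMuKernel
import Summits.BirchSwinnertonDyer.BirchSwinnertonDyer.Theorems.Rank2Observatory2DescParity
import Literature.NumberTheory.NumberFields.SelmerGroupPID
import Literature.NumberTheory.EllipticCurves.MordellWeilTheoremProofs
import HarnessLib

/-!
# BirchSwinnertonDyer — rank ≥ 2 observatory: the `V`-cover and the rank bound of the cubic-field 2-descent

HONEST FRAMING: per-curve certified theorems and census instruments; no claim on BSD in rank ≥ 2.

Assembly file of the KERNEL-2DESC generic library (design `b2b-bsdr2-cert-3/KERNEL-2DESC.md` §4,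
layer A4): for `E : y² = F(x) = x³ + Ax² + Bx + C` over `ℚ` with `F` irreducible, cubic field
`K = ℚ(θ)`, the image of the descent map `μ(P) = (x(P) − θ)·K×²` (files `…2DescMuMap`,
`…2DescMuKernel`) is confined to an explicit finite set of classes, and `rank E(ℚ)` is bounded by
its size:

* `mordellWeilRank_le_of_sqClass_cover` — if every `μ(P)` lies in a finite set `S ∋ 1` of
  square classes with `#S ≤ 2^s`, then `rank E(ℚ) ≤ s` (Mordell–Weil finiteness
  `module_finite_point_holds` + `ker μ = 2E(ℚ)` + the counting lemma);
* `exists_isSquare_descent_value` — for `𝓞 K` a PID: given generators `G` of the primes dividing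
  `F′(θ)` (up to association) and units `Wu` spanning `(𝓞 K)ˣ` modulo squares, every rational point
  has `(x − θ) · ∏_{T} Wu · ∏_{U} G ∈ K²` for some sub-products (parity file + the tree's
  Selmer-group lemma `exists_isSquare_mul_of_two_dvd_log_valuation`);
* `coverSet`, `sqClass_mem_coverSet`, `mordellWeilRank_le_of_coverSet` — hence, for any Boolean
  test `adm T U` that provably accepts every sub-product pair making `(x − θ)·∏∏` a square for a
  rational point (the per-curve local/sign conditions), `rank E(ℚ) ≤ s` as soon as the number of
  admissible pairs is `≤ 2^s`.

Sorry-free; axioms `propext`, `Classical.choice`, `Quot.sound`. Mathematics: Cassels, *Lectures on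
Elliptic Curves* (1991) §15 (the group `M ⊇ μ(𝔊)` generated by units and prime divisors of the
different-like element), Silverman AEC X.1.
-/

-- single-conjunct summit: `Summit.BirchSwinnertonDyer.BirchSwinnertonDyer.…` repeats the name by design
set_option linter.dupNamespace false

noncomputable section

open scoped Classical NumberField

open Literature.NumberTheory.EllipticCurves Literature.NumberTheory.NumberFields
open WeierstrassCurve WeierstrassCurve.Affine WeierstrassCurve.Affine.Point
open Polynomial

namespace Summit.BirchSwinnertonDyer.BirchSwinnertonDyer.Rank2Observatory.TwoDescCubic

/-! ## The rank bound from a finite cover of `μ(E(F))` -/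

section RankBound

variable {F K : Type*} [Field F] [NumberField F] [Field K] [CharZero K]

/-- **Rank bound of the cubic-field descent.** `E : y² = x³ + a₂x² + a₄x + a₆` over a number field
`F`, `φ : F → K`, `e ∈ K` a root of the cubic with `1, e, e²` an `F`-basis of `K`. If the classes
`(φ x − e)·K×²` of all `F`-points lie in a finite set `S ∋ 1` with `#S ≤ 2^s`, then
`rank E(F) ≤ s`. [cite: Cassels1991LecturesEllipticCurves, §15] -/
theorem mordellWeilRank_le_of_sqClass_cover (W : WeierstrassCurve F) [W.IsElliptic] (φ : F →+* K)
    {e : K} (ha₁ : W.a₁ = 0) (ha₃ : W.a₃ = 0)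
    (hroot : e ^ 3 + φ W.a₂ * e ^ 2 + φ W.a₄ * e + φ W.a₆ = 0)
    (hlin : ∀ c₀ c₁ c₂ : F, φ c₂ * e ^ 2 + φ c₁ * e + φ c₀ = 0 → c₀ = 0 ∧ c₁ = 0 ∧ c₂ = 0)
    (hspan : ∀ z : K, ∃ c₀ c₁ c₂ : F, z = φ c₂ * e ^ 2 + φ c₁ * e + φ c₀)
    (S : Finset (SqUnits K)) (h1 : (1 : SqUnits K) ∈ S)
    (hS : ∀ x y : F, W.toAffine.Nonsingular x y → sqClass (φ x - e) ∈ S)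
    {s : ℕ} (hcard : S.card ≤ 2 ^ s) : W.mordellWeilRank ≤ s := by
  haveI : Module.Finite ℤ W.toAffine.Point := W.module_finite_point_holds
  set ψ := muHom W.toAffine φ e (two_division_cubic_of_a ha₁ ha₃ hroot) (ne_of_powIndep hlin)
    with hψ
  have hker : ∀ P : W.toAffine.Point, ψ P = 0 → ∃ Q : W.toAffine.Point, P = 2 • Q :=
    fun P hP => muHom_ker_le ha₁ ha₃ hroot hlin hspan P hP
  have hS' : ∀ P : W.toAffine.Point, ψ P ∈ S.map (Equiv.toEmbedding Additive.ofMul) := by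
    intro P
    rw [Finset.mem_map_equiv]
    rcases P with _ | @⟨x, y, h⟩
    · show Additive.toMul (Additive.ofMul (muMap W.toAffine φ e 0)) ∈ S
      rw [muMap_zero]
      exact h1
    · simpa only [hψ, muHom_apply, muMap_some, Additive.ofMul_symm_eq, toMul_ofMul] using hS x y h
  have hb := two_pow_finrank_le_card ψ hker (S.map (Equiv.toEmbedding Additive.ofMul)) hS'
  rw [Finset.card_map] at hb
  rw [WeierstrassCurve.mordellWeilRank]
  exact (pow_le_pow_iff_right₀ (by norm_num : (1 : ℕ) < 2)).mp (hb.trans hcard)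

end RankBound

/-! ## The `V`-cover: `(x − θ) ∈ ⟨units, prime divisors of F′(θ)⟩ · K²` (PID case) -/

section VCover

open IsDedekindDomain NumberField Module

/-- A duplicate-free list drawn from an injective family is the product over the corresponding
index set. [folklore] -/
theorem list_prod_eq_finset_prod {M : Type*} [CommMonoid M] {s : ℕ} (G : Fin s → M)
    (hG : Function.Injective G) (l : List M) (hl : l.Nodup) (hmem : ∀ g ∈ l, g ∈ Set.range G) :
    l.prod = ∏ j ∈ Finset.univ.filter (fun j => G j ∈ l), G j := by
  have himage : (Finset.univ.filter (fun j => G j ∈ l)).image G = l.toFinset := by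
    ext g
    simp only [Finset.mem_image, Finset.mem_filter, Finset.mem_univ, true_and, List.mem_toFinset]
    constructor
    · rintro ⟨j, hj, rfl⟩
      exact hj
    · intro hg
      obtain ⟨j, rfl⟩ := hmem g hg
      exact ⟨j, hg, rfl⟩
  rw [← Finset.prod_image (f := fun g => g) (fun a _ b _ h => hG h), himage,
    List.prod_toFinset _ hl, List.map_id']

variable {K : Type*} [Field K] [NumberField K]

/-- **The `V`-cover of the cubic-field descent** (`𝓞 K` a PID). `θ ∈ 𝓞 K` a root of
`F = X³ + AX² + BX + C`, not rational; `G` an injective family containing, up to association, every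
prime of `𝓞 K` dividing `F′(θ) = 3θ² + 2Aθ + B`; `Wu` units spanning `(𝓞 K)ˣ` modulo squares.
Then for every rational point `(x, y)` of `y² = F(x)`, `(x − θ) · ∏_{i ∈ T} Wu i · ∏_{j ∈ U} G j`
is a square of `K` for some `T`, `U`: by the parity theorem `ord_𝔓(x − θ)` is even at every
`𝔓 ∤ F′(θ)`, so `(x − θ) = unit · (primes | F′(θ)) · square`.
[cite: Cassels1991LecturesEllipticCurves, §15] -/
theorem exists_isSquare_descent_value [IsPrincipalIdealRing (𝓞 K)] {A B C : ℤ} {θ : 𝓞 K}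
    (hF : θ ^ 3 + A * θ ^ 2 + B * θ + C = 0)
    (hθQ : ∀ q : ℚ, algebraMap ℚ K q ≠ algebraMap (𝓞 K) K θ)
    {s : ℕ} {G : Fin s → 𝓞 K} (hG : Function.Injective G)
    (hD : ∀ q : 𝓞 K, Prime q → q ∣ 3 * θ ^ 2 + 2 * A * θ + B → ∃ j, Associated q (G j))
    {m : ℕ} {Wu : Fin m → (𝓞 K)ˣ}
    (hW : ∀ u : (𝓞 K)ˣ, ∃ T : Finset (Fin m), IsSquare (u * ∏ i ∈ T, Wu i))
    {x y : ℚ} (hE : y ^ 2 = x ^ 3 + A * x ^ 2 + B * x + C) :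
    ∃ (T : Finset (Fin m)) (U : Finset (Fin s)),
      IsSquare ((algebraMap ℚ K x - algebraMap (𝓞 K) K θ) *
        (∏ i ∈ T, algebraMap (𝓞 K) K (Wu i)) * ∏ j ∈ U, algebraMap (𝓞 K) K (G j)) := by
  have hx : algebraMap ℚ K x ≠ algebraMap (𝓞 K) K θ := hθQ x
  have hξ : algebraMap ℚ K x - algebraMap (𝓞 K) K θ ≠ 0 := sub_ne_zero.mpr hx
  -- parity of `ord_𝔓 (x − θ)` at the primes `𝔓 ∤ F′(θ)`
  have hval : ∀ v : HeightOneSpectrum (𝓞 K),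
      (3 : 𝓞 K) * θ ^ 2 + 2 * (A : 𝓞 K) * θ + (B : 𝓞 K) ∉ v.asIdeal →
      (2 : ℤ) ∣ WithZero.log (v.valuation K (algebraMap ℚ K x - algebraMap (𝓞 K) K θ)) := by
    intro v hv
    have hE' : (algebraMap ℚ K y) ^ 2 = (algebraMap ℚ K x) ^ 3 +
        algebraMap (𝓞 K) K A * (algebraMap ℚ K x) ^ 2 + algebraMap (𝓞 K) K B * algebraMap ℚ K x +
          algebraMap (𝓞 K) K C := by
      have h := congrArg (algebraMap ℚ K) hE
      simp only [map_pow, map_add, map_mul, map_intCast] at h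
      simp only [map_intCast]
      exact h
    exact two_dvd_log_valuation_x_sub_theta v hF hv hx hE'
  -- the Selmer-group lemma of the tree (PID): `(x − θ) · u · ∏ l` is a square
  obtain ⟨u, l, hlG, hl, hsq⟩ :=
    exists_isSquare_mul_of_two_dvd_log_valuation
      ((3 : 𝓞 K) * θ ^ 2 + 2 * (A : 𝓞 K) * θ + (B : 𝓞 K)) (List.ofFn G)
      (fun q hq hqd => by
        obtain ⟨j, hj⟩ := hD q hq hqd
        exact ⟨G j, (List.mem_ofFn' G _).mpr ⟨j, rfl⟩, hj⟩) hξ hval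
  -- absorb the unit `u` by the explicit family
  obtain ⟨T, η, hη⟩ := hW u⁻¹
  refine ⟨T, Finset.univ.filter (fun j => G j ∈ l), ?_⟩
  have hl' : algebraMap (𝓞 K) K l.prod = ∏ j ∈ Finset.univ.filter (fun j => G j ∈ l),
      algebraMap (𝓞 K) K (G j) := by
    rw [list_prod_eq_finset_prod G hG l hl (fun g hg => (List.mem_ofFn' G g).mp (hlG g hg))]
    exact map_prod (algebraMap (𝓞 K) K) _ _
  have hT : (∏ i ∈ T, algebraMap (𝓞 K) K (Wu i)) = algebraMap (𝓞 K) K u *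
      (algebraMap (𝓞 K) K η * algebraMap (𝓞 K) K η) := by
    have h1 : (∏ i ∈ T, Wu i) = u * (η * η) := by rw [← hη, mul_inv_cancel_left]
    have h2 := congrArg (fun z : (𝓞 K)ˣ => algebraMap (𝓞 K) K (z : 𝓞 K)) h1
    simpa only [Units.coe_prod, Units.val_mul, map_prod, map_mul] using h2
  obtain ⟨r, hr⟩ := hsq
  rw [RingOfIntegers.coe_eq_algebraMap, RingOfIntegers.coe_eq_algebraMap] at hr
  refine ⟨r * algebraMap (𝓞 K) K η, ?_⟩
  rw [← hl', hT]
  linear_combination (algebraMap (𝓞 K) K η * algebraMap (𝓞 K) K η) * hr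

/-! ## The admissible-pair cover and the final rank bound -/

variable {m s : ℕ}

/-- The finite set of square classes `(∏_{T} Wu · ∏_{U} G)·K×²` over the pairs `(T, U)` accepted
by the Boolean test `adm` (the per-curve local / sign sieve). [folklore] -/
def coverSet (Wu : Fin m → (𝓞 K)ˣ) (G : Fin s → 𝓞 K)
    (adm : Finset (Fin m) → Finset (Fin s) → Bool) : Finset (SqUnits K) :=
  ((Finset.univ ×ˢ Finset.univ).filter
      (fun p : Finset (Fin m) × Finset (Fin s) => adm p.1 p.2 = true)).image
    (fun p => sqClass ((∏ i ∈ p.1, algebraMap (𝓞 K) K (Wu i)) * ∏ j ∈ p.2, algebraMap (𝓞 K) K (G j)))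

omit [NumberField K] in
/-- `#coverSet ≤ #{admissible pairs}`. [folklore] -/
theorem card_coverSet_le (Wu : Fin m → (𝓞 K)ˣ) (G : Fin s → 𝓞 K)
    (adm : Finset (Fin m) → Finset (Fin s) → Bool) :
    (coverSet Wu G adm).card ≤ ((Finset.univ ×ˢ Finset.univ).filter
      (fun p : Finset (Fin m) × Finset (Fin s) => adm p.1 p.2 = true)).card :=
  Finset.card_image_le

omit [NumberField K] in
/-- The trivial class is covered as soon as the empty pair is admissible. [folklore] -/
theorem one_mem_coverSet (Wu : Fin m → (𝓞 K)ˣ) (G : Fin s → 𝓞 K)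
    {adm : Finset (Fin m) → Finset (Fin s) → Bool} (h0 : adm ∅ ∅ = true) :
    (1 : SqUnits K) ∈ coverSet Wu G adm := by
  refine Finset.mem_image.mpr ⟨(∅, ∅), Finset.mem_filter.mpr
    ⟨Finset.mem_product.mpr ⟨Finset.mem_univ _, Finset.mem_univ _⟩, h0⟩, ?_⟩
  simp only [Finset.prod_empty, mul_one]
  simpa only [mul_one] using sqClass_mul_self (1 : K)

/-- **Cover theorem**: if `adm` accepts every pair `(T, U)` for which `(x − θ)·∏_{T} Wu·∏_{U} G` is
a square at some rational point, then the class `(x − θ)·K×²` of every rational point lies in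
`coverSet`. [cite: Cassels1991LecturesEllipticCurves, §15] -/
theorem sqClass_mem_coverSet [IsPrincipalIdealRing (𝓞 K)] {A B C : ℤ} {θ : 𝓞 K}
    (hF : θ ^ 3 + A * θ ^ 2 + B * θ + C = 0)
    (hθQ : ∀ q : ℚ, algebraMap ℚ K q ≠ algebraMap (𝓞 K) K θ)
    {G : Fin s → 𝓞 K} (hG : Function.Injective G) (hG0 : ∀ j, G j ≠ 0)
    (hD : ∀ q : 𝓞 K, Prime q → q ∣ 3 * θ ^ 2 + 2 * A * θ + B → ∃ j, Associated q (G j))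
    {Wu : Fin m → (𝓞 K)ˣ}
    (hW : ∀ u : (𝓞 K)ˣ, ∃ T : Finset (Fin m), IsSquare (u * ∏ i ∈ T, Wu i))
    {adm : Finset (Fin m) → Finset (Fin s) → Bool}
    (hadm : ∀ x y : ℚ, y ^ 2 = x ^ 3 + A * x ^ 2 + B * x + C →
      ∀ (T : Finset (Fin m)) (U : Finset (Fin s)),
        IsSquare ((algebraMap ℚ K x - algebraMap (𝓞 K) K θ) *
          (∏ i ∈ T, algebraMap (𝓞 K) K (Wu i)) * ∏ j ∈ U, algebraMap (𝓞 K) K (G j)) →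
        adm T U = true)
    {x y : ℚ} (hE : y ^ 2 = x ^ 3 + A * x ^ 2 + B * x + C) :
    sqClass (algebraMap ℚ K x - algebraMap (𝓞 K) K θ) ∈ coverSet Wu G adm := by
  obtain ⟨T, U, hsq⟩ := exists_isSquare_descent_value hF hθQ hG hD hW hE
  refine Finset.mem_image.mpr ⟨(T, U), Finset.mem_filter.mpr
    ⟨Finset.mem_product.mpr ⟨Finset.mem_univ _, Finset.mem_univ _⟩, hadm x y hE T U hsq⟩, ?_⟩
  set ξ := algebraMap ℚ K x - algebraMap (𝓞 K) K θ with hξdef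
  set z := (∏ i ∈ T, algebraMap (𝓞 K) K (Wu i)) * ∏ j ∈ U, algebraMap (𝓞 K) K (G j) with hzdef
  have hξ : ξ ≠ 0 := sub_ne_zero.mpr (hθQ x)
  have hz : z ≠ 0 := by
    refine mul_ne_zero (Finset.prod_ne_zero_iff.mpr fun i _ => ?_)
      (Finset.prod_ne_zero_iff.mpr fun j _ => ?_)
    · exact RingOfIntegers.coe_ne_zero_iff.mpr (Units.ne_zero (Wu i))
    · exact RingOfIntegers.coe_ne_zero_iff.mpr (hG0 j)
  obtain ⟨r, hr⟩ := hsq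
  have hprod : sqClass ξ * sqClass z = 1 := by
    rw [← sqClass_mul hξ hz, hzdef, ← mul_assoc, hr, sqClass_mul_self]
  show sqClass z = sqClass ξ
  calc sqClass z = 1 * sqClass z := (SqUnits.one_mul _).symm
    _ = sqClass ξ * sqClass ξ * sqClass z := by rw [SqUnits.mul_self]
    _ = sqClass ξ * (sqClass ξ * sqClass z) := by rw [mul_assoc]
    _ = sqClass ξ := by rw [hprod, SqUnits.mul_one]

/-- **Rank bound of the cubic-field 2-descent from certificates.** `E : y² = x³ + Ax² + Bx + C`
over `ℚ` with `F` irreducible and `K = ℚ(θ)` cubic with `𝓞 K` a PID; `G` an injective family of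
non-zero integers containing up to association every prime divisor of `F′(θ)`; `Wu` units spanning
`(𝓞 K)ˣ/(𝓞 K)ˣ²`; `adm` a Boolean sieve accepting every pair realised by a rational point, with the
empty pair admissible. Then `rank E(ℚ) ≤ s'` whenever the number of admissible pairs is `≤ 2^{s'}`.
[cite: Cassels1991LecturesEllipticCurves, §15] -/
theorem mordellWeilRank_le_of_coverSet [IsPrincipalIdealRing (𝓞 K)] {A B C : ℤ}
    (E : WeierstrassCurve ℚ) [E.IsElliptic] (ha₁ : E.a₁ = 0) (ha₂ : E.a₂ = A) (ha₃ : E.a₃ = 0)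
    (ha₄ : E.a₄ = B) (ha₆ : E.a₆ = C) (hirr : Irreducible (MonicCubic.polyQ A B C)) {θ : 𝓞 K}
    (hθ : aeval (algebraMap (𝓞 K) K θ) (MonicCubic.poly A B C) = 0) (h3 : finrank ℚ K = 3)
    {G : Fin s → 𝓞 K} (hG : Function.Injective G) (hG0 : ∀ j, G j ≠ 0)
    (hD : ∀ q : 𝓞 K, Prime q → q ∣ 3 * θ ^ 2 + 2 * A * θ + B → ∃ j, Associated q (G j))
    {Wu : Fin m → (𝓞 K)ˣ}
    (hW : ∀ u : (𝓞 K)ˣ, ∃ T : Finset (Fin m), IsSquare (u * ∏ i ∈ T, Wu i))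
    {adm : Finset (Fin m) → Finset (Fin s) → Bool} (h0 : adm ∅ ∅ = true)
    (hadm : ∀ x y : ℚ, y ^ 2 = x ^ 3 + A * x ^ 2 + B * x + C →
      ∀ (T : Finset (Fin m)) (U : Finset (Fin s)),
        IsSquare ((algebraMap ℚ K x - algebraMap (𝓞 K) K θ) *
          (∏ i ∈ T, algebraMap (𝓞 K) K (Wu i)) * ∏ j ∈ U, algebraMap (𝓞 K) K (G j)) →
        adm T U = true)
    {s' : ℕ} (hcard : ((Finset.univ ×ˢ Finset.univ).filter
      (fun p : Finset (Fin m) × Finset (Fin s) => adm p.1 p.2 = true)).card ≤ 2 ^ s') :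
    E.mordellWeilRank ≤ s' := by
  -- the cubic relation in `𝓞 K` and in `K`
  have hrootK := MonicCubic.theta_rel hθ
  have hF : θ ^ 3 + A * θ ^ 2 + B * θ + C = 0 := by
    apply RingOfIntegers.coe_injective
    simpa only [map_add, map_mul, map_pow, map_intCast, _root_.map_zero] using hrootK
  have hroot : (algebraMap (𝓞 K) K θ) ^ 3 + algebraMap ℚ K E.a₂ * (algebraMap (𝓞 K) K θ) ^ 2 +
      algebraMap ℚ K E.a₄ * algebraMap (𝓞 K) K θ + algebraMap ℚ K E.a₆ = 0 := by
    rw [ha₂, ha₄, ha₆]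
    simpa only [map_intCast] using hrootK
  have hlin := powIndep_algebraMap hirr hθ h3
  have hspan := exists_coords hirr hθ h3
  have hθQ : ∀ q : ℚ, algebraMap ℚ K q ≠ algebraMap (𝓞 K) K θ := ne_of_powIndep hlin
  refine mordellWeilRank_le_of_sqClass_cover E (algebraMap ℚ K) ha₁ ha₃ hroot hlin hspan
    (coverSet Wu G adm) (one_mem_coverSet Wu G h0) ?_ ((card_coverSet_le Wu G adm).trans hcard)
  intro x y hxy
  have hE : y ^ 2 = x ^ 3 + A * x ^ 2 + B * x + C := by
    have h := hxy.left
    rw [WeierstrassCurve.Affine.equation_iff] at h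
    have e₁ : E.toAffine.a₁ = 0 := ha₁
    have e₂ : E.toAffine.a₂ = A := ha₂
    have e₃ : E.toAffine.a₃ = 0 := ha₃
    have e₄ : E.toAffine.a₄ = B := ha₄
    have e₆ : E.toAffine.a₆ = C := ha₆
    rw [e₁, e₂, e₃, e₄, e₆] at h
    linear_combination h
  exact sqClass_mem_coverSet hF hθQ hG hG0 hD hW hadm hE

end VCover

end Summit.BirchSwinnertonDyer.BirchSwinnertonDyer.Rank2Observatory.TwoDescCubic

end
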